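import Summits.BirchSwinnertonDyer.BirchSwinnertonDyer.Theorems.ManinLocalTwoThreeKummerCubeSigmaTangentLine
import Literature.NumberTheory.EllipticCurves.ComplexTorus
import HarnessLib

/-!
# The `p = 2` twin of the `σ`-monodromy leaves, part 1: the `σ`-SQUARE ROOT of `x − x(T)` for a `2`-torsion point
# (route `ManinLocalTwoThree`, crux C2 `ManinOddAtFour` stmt-BirchSwinnertonDyer-22967; cell bsd-f2-manin, p2 gen 16 — generic leaves
# offered to the planners for the `p = 2` Kummer-SQUARE line (C2 v21 `stub_cuspidalKummerOddExponentOnCore` = E-an-53 on the core), by analogy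
# with the landed `p = 3` chain `…KummerCubeSigmaLeaves/TangentLine/Monodromy/NotCube`)

For a period pair `L` (lattice `Λ`), `a ∉ Λ` with `2a = m₁ω₁ + m₂ω₂ ∈ Λ` and `e = m₁η₁ + m₂η₂` (the quasi-period of `2a`):

* `sigmaSqRoot L a e w = exp(e·w/2)·σ(w − a)/σ(w)` — the `σ`-square root (junk `0` on `Λ`);
* `sigmaSqRoot_add_ω₁ / _add_ω₂` — multipliers `exp((e·ωᵢ − 2a·ηᵢ)/2)` (all `w`, junk values included), hence
  `sigmaSqRoot_add_of_mem_lattice`: a constant non-zero multiplier under every `μ ∈ Λ`;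
* **S3₂ `exists_weierstrassP_sub_eq_mul_sigmaSqRoot_sq`**: `∃ C ≠ 0, ∀ w ∉ Λ, ℘(w) − ℘(a) = C · sigmaSqRoot L a e w ²` — from the
  `σ`-difference formula `℘u − ℘v = −σ(u−v)σ(u+v)/(σu²σv²)` and the general quasi-periodicity
  `σ(z + 2a) = c·e^{e z}σ(z)` (`KummerCubeSigmaLeaves.exists_weierstrassSigma_add_period`); so `x − x(T)` is `C·V²` on `ℂ/Λ` minus `Λ`;
* **S3b₂ `sigmaSqRoot_not_periodic`**: `V = sigmaSqRoot L a e` is NOT `Λ`-periodic: by Legendre `η₁ω₂ − η₂ω₁ = ±2πi` the two multipliers are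
  `(−1)^{m₂}`, `(−1)^{m₁}`, and `m₁, m₂` are not both even since `a ∉ Λ` (the multiplier is the Weil pairing `e₂(π a, ·)`); evaluated at
  `w = a/2` where `V ≠ 0`;
* **S6₂ `exists_halfPeriod_of_twoTorsion_root`**: for a parametrisation datum `D` with `c ≠ 0` and a root `x₀` of the `2`-division cubic
  `4x³ + b₂x² + 2b₄x + b₆` of `W`, there is `a ∉ Λ` with `2a ∈ Λ` and `℘_Λ(a) = x₀ + b₂/12` (so `shortRoot W c x₀ = c²℘(a)`), by
  `℘'² = 4℘³ − g₂℘ − g₃` with the Néron normalisation `g₂ = c₄/12`, `g₃ = c₆/216` (`isNeronLattice`) and the depressed-cubic identity.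
What is NOT here (planner's design): the square-root monodromy on `ℍ` (part 2), the analytic dictionary for `Ξ_T = t_s²(x_s − e_s)` and the
descent «all `η`-exponents even ⟹ `Ξ_T` is a square in `K_M`».  HONEST FRAMING: routine `σ`-function identities; nothing about BSD or
Manin's conjecture is proved; C2 remains OPEN.
[cite: WhittakerWatson1927, §20.421 (quasi-periodicity of σ), §20.411 (Legendre), §20.53 (℘(u) − ℘(v) via σ)]
[cite: SilvermanAEC2009, VI.3 and III.8 (the multiplier of a σ-quotient with principal divisor class in E[2] is the Weil pairing; shape)]
-/

set_option autoImplicit false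
-- lint-debt: the directory name repeats the summit name (sibling precedent `ManinLocalTwoThreeKummerCubeSigmaLeaves.lean`)
set_option linter.dupNamespace false

noncomputable section

open Complex
open scoped PeriodPair
open WeierstrassCurve Literature.NumberTheory.EllipticCurves Literature.NumberTheory.EllipticCurves.ModularForms
open Summit.BirchSwinnertonDyer.Rank1Residual.ManinAdditive.CuspidalKummer
open Summit.BirchSwinnertonDyer.BirchSwinnertonDyer.Theorems.ManinLocalTwoThree.KummerCubeSigmaLeaves

namespace Summit.BirchSwinnertonDyer.BirchSwinnertonDyer.Theorems.ManinLocalTwoThree.SigmaSquareRoot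

/-- **The `σ`-square root** `V_{a,e}(w) = exp(e·w/2) · σ_Λ(w − a)/σ_Λ(w)` (junk `0` on `Λ`).  For `2a ∈ Λ ∌ a` and `e = η(2a)` its square
is `C⁻¹·(℘ − ℘(a))` (divisor `2(a) − 2(0)`), and `V(w + ω) = e₂(π a, π(ω/2))·V(w)`.
[cite: SilvermanAEC2009, VI.3 (σ-function; construction of elliptic functions with prescribed divisor)] -/
def sigmaSqRoot (L : PeriodPair) (a e w : ℂ) : ℂ :=
  cexp (e * w / 2) * L.weierstrassSigma (w - a) / L.weierstrassSigma w

/-! ### Multipliers -/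

/-- `V_{a,e}(w + ω₁) = exp((eω₁ − 2aη₁)/2)·V_{a,e}(w)` (quasi-periodicity of `σ`; holds at the junk values too).
[cite: WhittakerWatson1927, §20.421] -/
theorem sigmaSqRoot_add_ω₁ (L : PeriodPair) (a e w : ℂ) :
    sigmaSqRoot L a e (w + L.ω₁) = cexp ((e * L.ω₁ - 2 * a * L.η₁) / 2) * sigmaSqRoot L a e w := by
  unfold sigmaSqRoot
  rw [show w + L.ω₁ - a = (w - a) + L.ω₁ by ring, L.weierstrassSigma_add_ω₁_holds (w - a),
    L.weierstrassSigma_add_ω₁_holds w]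
  by_cases hw : L.weierstrassSigma w = 0
  · simp [hw]
  rw [show e * (w + L.ω₁) / 2 = e * w / 2 + (e * L.ω₁ - 2 * a * L.η₁) / 2 + L.η₁ * a by ring,
    show L.η₁ * ((w - a) + L.ω₁ / 2) = L.η₁ * (w + L.ω₁ / 2) - L.η₁ * a by ring,
    Complex.exp_add, Complex.exp_add, Complex.exp_sub]
  have h1 : cexp (L.η₁ * (w + L.ω₁ / 2)) ≠ 0 := Complex.exp_ne_zero _
  have h2 : cexp (L.η₁ * a) ≠ 0 := Complex.exp_ne_zero _
  field_simp

/-- `V_{a,e}(w + ω₂) = exp((eω₂ − 2aη₂)/2)·V_{a,e}(w)`. [cite: WhittakerWatson1927, §20.421] -/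
theorem sigmaSqRoot_add_ω₂ (L : PeriodPair) (a e w : ℂ) :
    sigmaSqRoot L a e (w + L.ω₂) = cexp ((e * L.ω₂ - 2 * a * L.η₂) / 2) * sigmaSqRoot L a e w := by
  unfold sigmaSqRoot
  rw [show w + L.ω₂ - a = (w - a) + L.ω₂ by ring, L.weierstrassSigma_add_ω₂_holds (w - a),
    L.weierstrassSigma_add_ω₂_holds w]
  by_cases hw : L.weierstrassSigma w = 0
  · simp [hw]
  rw [show e * (w + L.ω₂) / 2 = e * w / 2 + (e * L.ω₂ - 2 * a * L.η₂) / 2 + L.η₂ * a by ring,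
    show L.η₂ * ((w - a) + L.ω₂ / 2) = L.η₂ * (w + L.ω₂ / 2) - L.η₂ * a by ring,
    Complex.exp_add, Complex.exp_add, Complex.exp_sub]
  have h1 : cexp (L.η₂ * (w + L.ω₂ / 2)) ≠ 0 := Complex.exp_ne_zero _
  have h2 : cexp (L.η₂ * a) ≠ 0 := Complex.exp_ne_zero _
  field_simp

/-- The `σ`-square root has a constant non-zero multiplier under every lattice translation (the set of such translations is an additive
subgroup containing `ω₁, ω₂`). [cite: WhittakerWatson1927, §20.421] -/
theorem sigmaSqRoot_add_of_mem_lattice (L : PeriodPair) (a e : ℂ) {μ : ℂ} (hμ : μ ∈ L.lattice) :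
    ∃ ρ : ℂ, ρ ≠ 0 ∧ ∀ w : ℂ, sigmaSqRoot L a e (w + μ) = ρ * sigmaSqRoot L a e w := by
  let S : AddSubgroup ℂ :=
    { carrier := {μ | ∃ ρ : ℂ, ρ ≠ 0 ∧ ∀ w : ℂ, sigmaSqRoot L a e (w + μ) = ρ * sigmaSqRoot L a e w}
      zero_mem' := ⟨1, one_ne_zero, fun w ↦ by simp⟩
      add_mem' := by
        rintro μ₁ μ₂ ⟨ρ₁, hρ₁, h₁⟩ ⟨ρ₂, hρ₂, h₂⟩
        refine ⟨ρ₂ * ρ₁, mul_ne_zero hρ₂ hρ₁, fun w ↦ ?_⟩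
        rw [show w + (μ₁ + μ₂) = (w + μ₁) + μ₂ by ring, h₂, h₁, mul_assoc]
      neg_mem' := by
        rintro μ ⟨ρ, hρ, h⟩
        refine ⟨ρ⁻¹, inv_ne_zero hρ, fun w ↦ ?_⟩
        have := h (w + -μ)
        rw [show w + -μ + μ = w by ring] at this
        rw [this, inv_mul_cancel_left₀ hρ] }
  have h₁ : L.ω₁ ∈ S := ⟨_, Complex.exp_ne_zero _, sigmaSqRoot_add_ω₁ L a e⟩
  have h₂ : L.ω₂ ∈ S := ⟨_, Complex.exp_ne_zero _, sigmaSqRoot_add_ω₂ L a e⟩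
  obtain ⟨m, n, hmn⟩ := PeriodPair.mem_lattice.mp hμ
  have hmem : μ ∈ S := by
    rw [← hmn]
    refine S.add_mem ?_ ?_
    · simpa [zsmul_eq_mul] using S.zsmul_mem h₁ m
    · simpa [zsmul_eq_mul] using S.zsmul_mem h₂ n
  exact hmem

/-- `V_{a,e}(w) ≠ 0` off `Λ ∪ (a + Λ)`. [cite: WhittakerWatson1927, §20.42 (zeros of σ)] -/
theorem sigmaSqRoot_ne_zero (L : PeriodPair) (a e : ℂ) {w : ℂ} (hw : w ∉ L.lattice) (hwa : w - a ∉ L.lattice) :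
    sigmaSqRoot L a e w ≠ 0 := by
  unfold sigmaSqRoot
  exact div_ne_zero (mul_ne_zero (Complex.exp_ne_zero _) (L.weierstrassSigma_ne_zero hwa)) (L.weierstrassSigma_ne_zero hw)

/-! ### S3₂ — `x − x(T) = C·V²` -/

/-- **S3₂.**  For `a ∉ Λ` with `2a = m₁ω₁ + m₂ω₂` and `e = m₁η₁ + m₂η₂` there is `C ≠ 0` with `℘(w) − ℘(a) = C·V_{a,e}(w)²` for every
`w ∉ Λ`: `℘w − ℘a = −σ(w−a)σ(w+a)/(σw²σa²)` and `σ(w + a) = σ((w − a) + 2a) = c·e^{e(w−a)}σ(w − a)`, so `C = −c·e^{−ea}/σ(a)²`; on the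
coset `w ≡ a` both sides vanish. [cite: WhittakerWatson1927, §20.53, §20.421] -/
theorem exists_weierstrassP_sub_eq_mul_sigmaSqRoot_sq (L : PeriodPair) {a : ℂ} {m₁ m₂ : ℤ} (ha : a ∉ L.lattice)
    (h2a : 2 * a = m₁ * L.ω₁ + m₂ * L.ω₂) :
    ∃ C : ℂ, C ≠ 0 ∧ ∀ w : ℂ, w ∉ L.lattice →
      ℘[L] w - ℘[L] a = C * sigmaSqRoot L a (m₁ * L.η₁ + m₂ * L.η₂) w ^ 2 := by
  set η : ℂ := m₁ * L.η₁ + m₂ * L.η₂ with hη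
  obtain ⟨c, hc, -, hper⟩ := exists_weierstrassSigma_add_period L m₁ m₂
  rw [← hη, ← h2a] at hper
  have hσa : L.weierstrassSigma a ≠ 0 := L.weierstrassSigma_ne_zero ha
  obtain ⟨B, hB⟩ : ∃ B : ℂ, cexp (-(η * a)) = B := ⟨_, rfl⟩
  have hB0 : B ≠ 0 := by rw [← hB]; exact Complex.exp_ne_zero _
  refine ⟨-(c * B) / L.weierstrassSigma a ^ 2,
    div_ne_zero (neg_ne_zero.mpr (mul_ne_zero hc hB0)) (pow_ne_zero 2 hσa), fun w hw ↦ ?_⟩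
  have hσw : L.weierstrassSigma w ≠ 0 := L.weierstrassSigma_ne_zero hw
  by_cases hwa : w - a ∈ L.lattice
  · -- `w ≡ a`: both sides vanish
    have hw' : w = a + (w - a) := by ring
    have h℘w : ℘[L] w = ℘[L] a := by rw [hw']; exact L.weierstrassP_add_coe a ⟨w - a, hwa⟩
    have hσ0 : L.weierstrassSigma (w - a) = 0 := (L.weierstrassSigma_eq_zero_iff_holds _).mpr hwa
    rw [h℘w, sigmaSqRoot, hσ0]
    simp
  rw [L.weierstrassP_sub_eq_sigma_holds w a hw ha, show w + a = (w - a) + 2 * a by ring, hper (w - a), sigmaSqRoot]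
  have hE : cexp (η * (w - a)) = B * cexp (η * w / 2) ^ 2 := by
    rw [← hB, ← Complex.exp_nat_mul, ← Complex.exp_add]; congr 1; push_cast; ring
  rw [hE]
  obtain ⟨E, hE'⟩ : ∃ E : ℂ, cexp (η * w / 2) = E := ⟨_, rfl⟩
  rw [hE']
  field_simp

/-! ### S3b₂ — `V` is not `Λ`-periodic (a Weil sign is `−1`) -/

/-- `exp(m · (s·2πi) / 2) = 1` with `s = ±1` forces `2 ∣ m`. [folklore] -/
theorem two_dvd_of_cexp_eq_one {s m : ℤ} (hs : s = 1 ∨ s = -1)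
    (h : cexp ((m : ℂ) * ((s : ℂ) * (2 * Real.pi * I)) / 2) = 1) : (2 : ℤ) ∣ m := by
  obtain ⟨n, hn⟩ := Complex.exp_eq_one_iff.mp h
  have h2πI : (2 * Real.pi * I : ℂ) ≠ 0 := by
    simp [Real.pi_ne_zero, Complex.I_ne_zero]
  have hms : ((m * s : ℤ) : ℂ) = ((2 * n : ℤ) : ℂ) := by
    field_simp at hn
    push_cast
    linear_combination hn
  have hz : m * s = 2 * n := by exact_mod_cast hms
  rcases hs with rfl | rfl
  · exact ⟨n, by linarith⟩
  · exact ⟨-n, by linarith⟩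

/-- **S3b₂.**  For `a ∉ Λ` with `2a = m₁ω₁ + m₂ω₂`, the `σ`-square root `V = V_{a,η(2a)}` is not `Λ`-periodic: its multipliers at
`ω₁`, `ω₂` are `exp(m₂(η₂ω₁ − η₁ω₂)/2) = (−1)^{m₂}` and `exp(m₁(η₁ω₂ − η₂ω₁)/2) = (−1)^{m₁}` (Legendre), and `m₁`, `m₂` are not both even
because `a ∉ Λ`; evaluated at `w = a/2`, where `V ≠ 0`. [cite: WhittakerWatson1927, §20.421, §20.411]
[cite: SilvermanAEC2009, III.8 (the multiplier is the Weil pairing e₂; shape)] -/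
theorem sigmaSqRoot_not_periodic (L : PeriodPair) {a : ℂ} {m₁ m₂ : ℤ} (ha : a ∉ L.lattice)
    (h2a : 2 * a = m₁ * L.ω₁ + m₂ * L.ω₂) :
    ∃ ω ∈ L.lattice, ∃ w : ℂ,
      sigmaSqRoot L a (m₁ * L.η₁ + m₂ * L.η₂) (w + ω) ≠ sigmaSqRoot L a (m₁ * L.η₁ + m₂ * L.η₂) w := by
  set e : ℂ := m₁ * L.η₁ + m₂ * L.η₂ with he
  -- the base point `a/2`: `a/2 ∉ Λ`, `a/2 − a ∉ Λ`
  have hh : a / 2 ∉ L.lattice := fun h ↦ ha (by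
    have := L.lattice.add_mem h h
    rwa [add_halves] at this)
  have hha : a / 2 - a ∉ L.lattice := fun h ↦ hh (by
    have := L.lattice.neg_mem h
    rwa [show -(a / 2 - a) = a / 2 by ring] at this)
  have hV0 := sigmaSqRoot_ne_zero L a e hh hha
  -- not both `m₁`, `m₂` even
  have hnd : ¬ ((2 : ℤ) ∣ m₁ ∧ (2 : ℤ) ∣ m₂) := by
    rintro ⟨⟨k₁, hk₁⟩, ⟨k₂, hk₂⟩⟩
    apply ha
    rw [PeriodPair.mem_lattice]
    refine ⟨k₁, k₂, ?_⟩
    have h2 : (2 : ℂ) * a = 2 * (k₁ * L.ω₁ + k₂ * L.ω₂) := by rw [h2a, hk₁, hk₂]; push_cast; ring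
    exact (mul_left_cancel₀ (by norm_num : (2 : ℂ) ≠ 0) h2).symm
  -- Legendre: `η₁ω₂ − η₂ω₁ = s·2πi`, `s = ±1`
  obtain ⟨s, hs, hδ⟩ : ∃ s : ℤ, (s = 1 ∨ s = -1) ∧ L.η₁ * L.ω₂ - L.η₂ * L.ω₁ = (s : ℂ) * (2 * Real.pi * I) := by
    rcases L.im_ω₂_div_ω₁_pos_or with h | h
    · exact ⟨1, Or.inl rfl, by rw [L.legendre_relation_holds h]; simp⟩
    · refine ⟨-1, Or.inr rfl, ?_⟩
      have h' := L.legendre_relation_of_neg h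
      linear_combination -h'
  by_cases hm₁ : (2 : ℤ) ∣ m₁
  · -- use `ω₁`: multiplier `exp(−m₂ s πi)`, and `2 ∤ m₂`
    have hm₂ : ¬ (2 : ℤ) ∣ m₂ := fun h ↦ hnd ⟨hm₁, h⟩
    refine ⟨L.ω₁, L.ω₁_mem_lattice, a / 2, fun hper ↦ hm₂ ?_⟩
    rw [sigmaSqRoot_add_ω₁ L a e] at hper
    have hexp : cexp ((e * L.ω₁ - 2 * a * L.η₁) / 2) = 1 :=
      mul_right_cancel₀ hV0 (hper.trans (one_mul _).symm)
    have hE : (e * L.ω₁ - 2 * a * L.η₁) / 2 = ((-m₂ : ℤ) : ℂ) * ((s : ℂ) * (2 * Real.pi * I)) / 2 := by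
      rw [he, h2a]
      push_cast
      linear_combination (-(m₂ : ℂ) / 2) * hδ
    rw [hE] at hexp
    exact (dvd_neg).mp (two_dvd_of_cexp_eq_one hs hexp)
  · -- use `ω₂`: multiplier `exp(m₁ s πi)`
    refine ⟨L.ω₂, L.ω₂_mem_lattice, a / 2, fun hper ↦ hm₁ ?_⟩
    rw [sigmaSqRoot_add_ω₂ L a e] at hper
    have hexp : cexp ((e * L.ω₂ - 2 * a * L.η₂) / 2) = 1 :=
      mul_right_cancel₀ hV0 (hper.trans (one_mul _).symm)
    have hE : (e * L.ω₂ - 2 * a * L.η₂) / 2 = ((m₁ : ℤ) : ℂ) * ((s : ℂ) * (2 * Real.pi * I)) / 2 := by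
      rw [he, h2a]
      linear_combination ((m₁ : ℂ) / 2) * hδ
    rw [hE] at hexp
    exact two_dvd_of_cexp_eq_one hs hexp

/-! ### S6₂ — a rational `2`-torsion abscissa lifts to a half-period -/

/-- **S6₂.**  For a parametrisation datum `D` (Néron lattice `Λ = D.L`: `g₂ = c₄(W)/12`, `g₃ = c₆(W)/216`) and a root `x₀` of the
`2`-division cubic `4x³ + b₂x² + 2b₄x + b₆` of `W` (over any field containing `ℚ`, here read in `ℂ`), there is a half-period `a`
(`a ∉ Λ`, `2a ∈ Λ`) with `℘_Λ(a) = x₀ + b₂/12`; hence `x_s(T) = shortRoot W c x₀ = c²℘_Λ(a)` on the short model.  Proof: `℘` is onto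
(`exists_weierstrassP_eq`), `℘'(a)² = 4℘(a)³ − g₂℘(a) − g₃ = 4x₀³ + b₂x₀² + 2b₄x₀ + b₆ = 0` (depressed cubic), and `℘'(a) = 0 ⟹ 2a ∈ Λ`.
[cite: SilvermanAEC2009, VI.3.6 (uniformisation), III.1 (b₂, c₄, c₆; shape)] -/
theorem exists_halfPeriod_of_twoTorsion_root {W : WeierstrassCurve ℚ} [W.IsElliptic] {N : ℕ} [NeZero N]
    (D : ModularParametrizationData W N) {x₀ : ℚ} (hx : W.twoTorsionPolynomial.toPoly.IsRoot x₀) :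
    ∃ a : ℂ, a ∉ D.L.lattice ∧ 2 * a ∈ D.L.lattice ∧ ℘[D.L] a = (x₀ : ℂ) + (W.b₂ : ℂ) / 12 := by
  obtain ⟨a, ha, h℘⟩ := D.L.exists_weierstrassP_eq ((x₀ : ℂ) + (W.b₂ : ℂ) / 12)
  have hg₂ : D.L.g₂ = (W.c₄ : ℂ) / 12 := by
    have h := D.isNeronLattice.1; rw [WeierstrassCurve.baseChange, map_c₄] at h; simpa using h
  have hg₃ : D.L.g₃ = (W.c₆ : ℂ) / 216 := by
    have h := D.isNeronLattice.2; rw [WeierstrassCurve.baseChange, map_c₆] at h; simpa using h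
  have hroot : (4 : ℂ) * x₀ ^ 3 + W.b₂ * x₀ ^ 2 + 2 * W.b₄ * x₀ + W.b₆ = 0 := by
    have h := hx
    rw [Polynomial.IsRoot, WeierstrassCurve.twoTorsionPolynomial, Cubic.toPoly] at h
    simp only [Polynomial.eval_add, Polynomial.eval_mul, Polynomial.eval_pow, Polynomial.eval_C, Polynomial.eval_X] at h
    have h' := congrArg (fun q : ℚ ↦ (q : ℂ)) h
    push_cast at h'
    linear_combination h'
  have h℘' : ℘'[D.L] a = 0 := by
    have hsq := D.L.derivWeierstrassP_sq a ha
    rw [h℘, hg₂, hg₃, WeierstrassCurve.c₄, WeierstrassCurve.c₆] at hsq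
    push_cast at hsq
    have h0 : ℘'[D.L] a ^ 2 = 0 := by rw [hsq]; linear_combination hroot
    exact pow_eq_zero_iff (n := 2) (by norm_num) |>.mp h0
  exact ⟨a, ha, D.L.two_mul_mem_lattice_of_derivWeierstrassP_eq_zero ha h℘', h℘⟩

/-- **S6₂, short-model form**: with `a` as above, `shortRoot W c x₀ = c²·℘_Λ(a)` in `ℂ`. [folklore] -/
theorem shortRoot_eq_of_weierstrassP_eq (W : WeierstrassCurve ℚ) (c : ℤ) {x₀ : ℚ} {L : PeriodPair} {a : ℂ}
    (h℘ : ℘[L] a = (x₀ : ℂ) + (W.b₂ : ℂ) / 12) :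
    ((shortRoot W c x₀ : ℚ) : ℂ) = (c : ℂ) ^ 2 * ℘[L] a := by
  rw [shortRoot, h℘]; push_cast; ring

end Summit.BirchSwinnertonDyer.BirchSwinnertonDyer.Theorems.ManinLocalTwoThree.SigmaSquareRoot

end
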